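import Literature.Combinatorics.StablePolynomials.JensenMultipliersMultivariate
import HarnessLib

/-!
# Jensen multipliers in half of the variables (Borcea–Brändén I, §5.3: the operator `Λ̄`)

J. Borcea, P. Brändén, *The Lee–Yang and Pólya–Schur programs. I. Linear operators preserving stability*,
Invent. Math. 177 (2009) 541–569 (arXiv:0809.0401), §5.3 (proof of Theorem 5.1, necessity part):

> Given `β ∈ ℕⁿ` let `Λ` be the linear operator on `ℂ[w_1,…,w_n]` defined by `w^α ↦ (β)_α w^α`, `α ∈ ℕⁿ`, and
> extend it to a linear operator `Λ̄` on `ℂ[z_1,…,z_n,w_1,…,w_n]` by letting `Λ̄[z^γ w^α] = z^γ Λ[w^α]`,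
> `α, γ ∈ ℕⁿ`. We claim that `Λ̄` preserves stability in `2n` variables. Indeed, this amounts to saying that its
> restriction `Λ̄_κ` to `ℂ_κ[z,w]` preserves stability for each `κ ∈ ℕ^{2n}`. The latter statement is an immediate
> consequence of the fact that `Λ` preserves stability in `n` variables (by Lemma 5.2) combined with Theorem 1.1
> and a straightforward computation showing that the symbol `G_{Λ̄_κ}` of `Λ̄_κ` is a stable polynomial in `4n`
> variables. … To prove the converse … `F_m(z,w) := Σ_{α ≤ β_m} J(α,β_m) P_α(z) w^α
> = Σ_{α ≤ β_m} (β_m)_α P_α(z) (w/m)^α ∈ 𝓗_{2n}(ℂ) ∪ {0}`.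

For a *polynomial* `F(z,w) = Σ_α P_α(z) w^α` these are the statements that `Σ_{α ≤ β} (β)_α P_α(z) w^α` and
`Σ_{α ≤ β} J(α,β) P_α(z) w^α` are stable or identically zero whenever `F` is stable. In the tree's language
`Λ̄` is the diagonal operator on `ℂ[z_τ,w_τ]` (variables `τ ⊕ τ`, `Sum.inl` = `z`, `Sum.inr` = `w`) with the
*product* multiplier `Π_{j ∈ τ ⊕ τ} c_j(s_j)`, `c_{z_i} ≡ 1`, `c_{w_i}(k) = (β_i)_k`; the "straightforward
computation" of the symbol is the factorisation of `JensenMultipliersMultivariate.lean`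
(`mvMultiplierOp_prod_stable_or_zero`), the trivial factors contributing `(1+t)^{κ_j}`
(`binomialForm_const_one_roots`). The `J`-version is `Λ̄` composed with the rescaling `w_i ↦ w_i/β_i`
(`wJensenOp_eq_comp`). The analytic part of Theorem 5.1 (power series, normal families) is not treated here.

## Contents

* `binomialForm_const_one_roots`; `wDescFactorialOp β = Λ̄`: `wDescFactorialOp_eq`, `wDescFactorialOp_monomial`,
  **`wDescFactorialOp_stable_or_zero`**; `wJensenOp β`: `wJensenOp_monomial`, `wJensenOp_eq_comp`,
  **`wJensenOp_stable_or_zero`**.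

## References

* [BorceaBranden2009] J. Borcea, P. Brändén, Invent. Math. 177 (2009) 541–569, §5.3 (proof of Thm. 5.1), §5.1
  Lemma 5.2.
-/

noncomputable section

open MvPolynomial Finset

namespace Literature.Combinatorics.StablePolynomials

variable {τ : Type*}

/-! ## §1 The trivial multiplier: `Σ_k binom(n,k) t^k = (1+t)^n` -/

section Trivial

/-- **`Σ_{k≤n} binom(n,k) t^k = (1+t)^n` has the single zero `t = -1`** (real, `≤ 0`), so the constant multiplier
sequence `1` satisfies the root condition of the product-multiplier theorem. [cite: BorceaBranden2009, §5.3 (proof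
of Thm. 5.1: "`Λ̄[z^γ w^α] = z^γ Λ[w^α]`", the `z`-variables are untouched)] -/
theorem binomialForm_const_one_roots (n : ℕ) (t : ℂ) (ht : (binomialForm n fun _ => (1 : ℂ)).eval t = 0) :
    t.im = 0 ∧ t.re ≤ 0 := by
  have h : (binomialForm n fun _ => (1 : ℂ)).eval t = (t + 1) ^ n := by
    rw [eval_binomialForm, add_pow]
    refine sum_congr rfl fun k _ => ?_
    rw [one_pow, mul_one, mul_one, mul_comm]
  rw [h] at ht
  rcases Nat.eq_zero_or_pos n with hn | hn
  · rw [hn, pow_zero] at ht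
    exact absurd ht one_ne_zero
  · have ht1 : t = -1 := eq_neg_of_add_eq_zero_left ((pow_eq_zero_iff hn.ne').1 ht)
    rw [ht1, Complex.neg_im, Complex.one_im, neg_zero, Complex.neg_re, Complex.one_re]
    exact ⟨rfl, by norm_num⟩

end Trivial

/-! ## §2 The operator `Λ̄`: `z^γ w^α ↦ (β)_α z^γ w^α` -/

section Lambda

variable [Fintype τ]

/-- **`Λ̄`**: the diagonal operator `z^γ w^α ↦ (β)_α z^γ w^α` on `ℂ[z_τ, w_τ]` (variables `τ ⊕ τ`; `Sum.inl` = `z`,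
`Sum.inr` = `w`), i.e. the Jensen multiplier `Λ` of Lemma 5.2 acting on the `w`-exponents only.
[cite: BorceaBranden2009, §5.3 ("extend it to a linear operator `Λ̄` … by letting `Λ̄[z^γ w^α] = z^γ Λ[w^α]`")] -/
def wDescFactorialOp (β : τ → ℕ) : MvPolynomial (τ ⊕ τ) ℂ →ₗ[ℂ] MvPolynomial (τ ⊕ τ) ℂ :=
  mvMultiplierOp fun s => ∏ i, (((β i).descFactorial (s (Sum.inr i)) : ℕ) : ℂ)

/-- The multiplier family of `Λ̄` per variable: `1` on `z_i`, `(β_i)_k` on `w_i`.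
[cite: BorceaBranden2009, §5.3 (definition of `Λ̄`)] -/
def wDescFactorialSeq (β : τ → ℕ) : τ ⊕ τ → ℕ → ℂ :=
  Sum.elim (fun _ _ => 1) fun i k => (((β i).descFactorial k : ℕ) : ℂ)

/-- **`Λ̄` is a product multiplier over all `2n` variables** (trivial factors on the `z`-side).
[cite: BorceaBranden2009, §5.3 ("a straightforward computation showing that the symbol of `Λ̄_κ` is a stable
polynomial in `4n` variables")] -/
theorem wDescFactorialOp_eq (β : τ → ℕ) :
    wDescFactorialOp β = mvMultiplierOp fun s : τ ⊕ τ →₀ ℕ => ∏ j, wDescFactorialSeq β j (s j) := by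
  unfold wDescFactorialOp
  congr 1
  funext s
  rw [Fintype.prod_sum_type]
  simp only [wDescFactorialSeq, Sum.elim_inl, Sum.elim_inr, prod_const_one, one_mul]

/-- **`Λ̄[c z^γ w^α] = (β)_α c z^γ w^α`** ("`Λ̄[z^γ w^α] = z^γ Λ[w^α]`"). [cite: BorceaBranden2009, §5.3] -/
theorem wDescFactorialOp_monomial (β : τ → ℕ) (s : τ ⊕ τ →₀ ℕ) (c : ℂ) :
    wDescFactorialOp β (monomial s c) =
      monomial s ((multiDescFactorial β (fun i => s (Sum.inr i)) : ℂ) * c) := by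
  rw [wDescFactorialOp, mvMultiplierOp_monomial, multiDescFactorial, Nat.cast_prod]

variable [DecidableEq τ]

/-- **"`Λ̄` preserves stability in `2n` variables"**: for every stable `F ∈ ℂ[z_τ, w_τ]`,
`Λ̄F = Σ_{α ≤ β} (β)_α P_α(z) w^α` (where `F = Σ_α P_α(z) w^α`) is stable or identically zero — the polynomial case of
the necessity part of Theorem 5.1. [cite: BorceaBranden2009, §5.3 (proof of Thm. 5.1: "We claim that `Λ̄`
preserves stability in `2n` variables")] -/
theorem wDescFactorialOp_stable_or_zero (β : τ → ℕ) {F : MvPolynomial (τ ⊕ τ) ℂ} (hF : IsUpperHalfPlaneStable F) :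
    IsUpperHalfPlaneStable (wDescFactorialOp β F) ∨ wDescFactorialOp β F = 0 := by
  rw [wDescFactorialOp_eq]
  refine mvMultiplierOp_prod_stable_or_zero (c := wDescFactorialSeq β) (fun j n t ht => ?_) hF
  rcases j with i | i
  · exact binomialForm_const_one_roots n t ht
  · exact binomialForm_descFactorial_roots n (β i) t ht

end Lambda

/-! ## §3 The `J`-version: `z^γ w^α ↦ J(α,β) z^γ w^α` -/

section Jensen

variable [Fintype τ]

/-- **The operator `z^γ w^α ↦ J(α,β) z^γ w^α`** producing `F_m = Σ_{α≤β} J(α,β) P_α(z) w^α` from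
`F = Σ_α P_α(z) w^α`. [cite: BorceaBranden2009, §5.3 ("`F_m(z,w) := Σ_{α ≤ β_m} J(α,β_m) P_α(z) w^α`")] -/
def wJensenOp (β : τ → ℕ) : MvPolynomial (τ ⊕ τ) ℂ →ₗ[ℂ] MvPolynomial (τ ⊕ τ) ℂ :=
  mvMultiplierOp fun s => jensenJ ℂ (fun i => s (Sum.inr i)) β

/-- `z^γ w^α ↦ J(α,β) z^γ w^α` on monomials. [cite: BorceaBranden2009, §5.3] -/
theorem wJensenOp_monomial (β : τ → ℕ) (s : τ ⊕ τ →₀ ℕ) (c : ℂ) :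
    wJensenOp β (monomial s c) = monomial s (jensenJ ℂ (fun i => s (Sum.inr i)) β * c) :=
  mvMultiplierOp_monomial _ s c

/-- The rescaling of the `w`-variables by `1/β_i` (and of no `z`-variable).
[cite: BorceaBranden2009, §5.3 ("`= Σ_{α ≤ β_m} (β_m)_α P_α(z) (w/m)^α`")] -/
def wJensenScale (β : τ → ℕ) : τ ⊕ τ → ℝ :=
  Sum.elim (fun _ => 1) (jensenScale β)

omit [Fintype τ] in
/-- The rescaling constants are positive. [cite: BorceaBranden2009, §5.3] -/
theorem wJensenScale_pos (β : τ → ℕ) (j : τ ⊕ τ) : 0 < wJensenScale β j := by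
  rcases j with i | i
  · exact one_pos
  · exact jensenScale_pos β i

/-- **`F_m` is `Λ̄F` after rescaling the `w`-variables**: `(z^γ w^α ↦ J(α,β) z^γ w^α) = Λ̄ ∘ (w_i ↦ w_i/β_i)`.
[cite: BorceaBranden2009, §5.3 ("`Σ J(α,β_m) P_α(z) w^α = Σ (β_m)_α P_α(z) (w/m)^α`")] -/
theorem wJensenOp_eq_comp (β : τ → ℕ) :
    wJensenOp β = wDescFactorialOp β ∘ₗ (scaleOp (wJensenScale β)).toLinearMap := by
  rw [wDescFactorialOp, mvMultiplierOp_comp_scaleOp, wJensenOp]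
  congr 1
  funext s
  rw [jensenJ_eq_mul_prod, Fintype.prod_sum_type]
  simp only [wJensenScale, Sum.elim_inl, Sum.elim_inr, Complex.ofReal_one, one_pow, prod_const_one, one_mul]

variable [DecidableEq τ]

/-- **`F_m ∈ 𝓗_{2n} ∪ {0}`** (polynomial case): for every stable `F = Σ_α P_α(z) w^α ∈ ℂ[z_τ,w_τ]`,
`Σ_{α ≤ β} J(α,β) P_α(z) w^α` is stable or identically zero. [cite: BorceaBranden2009, §5.3 (proof of Thm. 5.1:
"`F_m(z,w) … ∈ 𝓗_{2n}(ℂ) ∪ {0}`")] -/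
theorem wJensenOp_stable_or_zero (β : τ → ℕ) {F : MvPolynomial (τ ⊕ τ) ℂ} (hF : IsUpperHalfPlaneStable F) :
    IsUpperHalfPlaneStable (wJensenOp β F) ∨ wJensenOp β F = 0 := by
  rw [wJensenOp_eq_comp, LinearMap.comp_apply, AlgHom.toLinearMap_apply]
  exact wDescFactorialOp_stable_or_zero β (isUpperHalfPlaneStable_scaleOp (wJensenScale_pos β) hF)

end Jensen

end Literature.Combinatorics.StablePolynomials

end
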